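import Literature.AlgebraicGeometry.HodgeTheory.BettiUniverseAxioms
import Literature.AlgebraicGeometry.Motives.FamiliesVHS
import HarnessLib

/-!
# Fibrewise endomorphisms of a family and the cohomological quaternion relations of a deck pair

Layer `Literature/AlgebraicGeometry/HodgeTheory`. One plumbing definition (`Motives.fiberOverEnd`, the endomorphism of a
fibre induced by an endomorphism of the family over the base) and theorems; no named fact. Written by the prover seat
`hodge-nonav-19716-p2` (g13, cell `hodge-nonav`) as brick **M1-d (d-i)** (p3 g36 ruling 2026-08-29T09:28:01Z) for
prover-Bx's programme M1 «the deck pair on a smooth projective family model» (memo `PROGRAMME-M1-Bx-g19.md` §0: the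
target `Q8FamilyDeck e` carries `τ j : 𝒳 ⟶ 𝒳` over the base with `τ ≫ τ ≫ τ ≫ τ = 𝟙`, `j ≫ j = τ ≫ τ`,
`τ ≫ j ≫ τ = j`) of route `HodgeConjecture/Q8SymplecticPowers` (crux K1Q, stmt-HodgeConjecture-24190): the leaf
`Q8SurfacePowersHodge` and K1Q/K2Q take as BINDERS the COHOMOLOGICAL relations
`pull τ 2 ^ 4 = 1 ∧ pull j 2 ^ 2 = pull τ 2 ^ 2 ∧ pull j 2 * pull τ 2 = pull τ 2 ^ 3 * pull j 2` on `H²` of a fibre;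
this file derives them from the GEOMETRIC relations by functoriality of `pull` alone.

* `Motives.fiberOverEnd π τ hτ s : fiberOver π s ⟶ fiberOver π s` — the endomorphism `τ ×_S Spec k` of the fibre over a
  rational point `s` induced by an endomorphism `τ` of `𝒳` over `π : 𝒳 ⟶ S` (`hτ : τ ≫ π = π`); `fiberOverEnd_comp_fiberι`,
  **functoriality** `fiberOverEnd_id`, `fiberOverEnd_comp`, and `fiberOverEnd_congr`.
* `BettiUniverse.pull_comp_eq_mul` (`(f ≫ g)^* = f^* * g^*` in `Module.End`), **`BettiUniverse.quaternionRelations_pull`** —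
  for endomorphisms `τ j` of ANY `ℂ`-scheme with `τ⁴ = 𝟙`, `j² = τ²`, `τjτ = j`: `(τ^*)⁴ = 1`, `(j^*)² = (τ^*)²`,
  `j^* τ^* = (τ^*)³ j^*` in every degree; **`BettiUniverse.quaternionRelations_pull_fiberOverEnd`** — the same for the
  fibre endomorphisms of a deck pair over a base, in every degree (degree `2` is the leaf's binder).

Honest scope: functoriality bookkeeping; nothing here bears on HC, and the p_g-clauses of the leaf are NOT addressed
(they are the non-vacuity certificate NONVAC-Q, memo `SCOPING-M1d-ii-19716p2-g13.md`).

## References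

* [HatcherAT2002] A. Hatcher, Algebraic Topology (2002), §3.1 p. 198 (functoriality of induced maps in cohomology).
* [Fulton1998] W. Fulton, Intersection Theory, 2nd ed. (1998), §10.1 (induced morphisms on fibres).
-/

noncomputable section

set_option backward.isDefEq.respectTransparency false

open CategoryTheory CategoryTheory.Limits AlgebraicGeometry

universe u

namespace Literature.AlgebraicGeometry.Motives

section FibreEnd

variable {k : Type u} [Field k] {𝒳 S : SchemeOver k} (π : 𝒳 ⟶ S)

/-- **The endomorphism of a fibre induced by an endomorphism over the base**: for `τ : 𝒳 ⟶ 𝒳` with `τ ≫ π = π`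
and a rational point `s`, the morphism `τ ×_S Spec k : 𝒳_s ⟶ 𝒳_s` (functoriality of the fibre product; Fulton §10.1).
[cite: Fulton1998, §10.1] -/
def fiberOverEnd (τ : 𝒳 ⟶ 𝒳) (hτ : τ ≫ π = π) (s : AlgPoints S k) : fiberOver π s ⟶ fiberOver π s :=
  Over.homMk
    (pullback.lift (pullback.fst π.left s.left ≫ τ.left) (pullback.snd π.left s.left)
      (by rw [Category.assoc, ← Over.comp_left, hτ]; exact pullback.condition))
    (by
      change pullback.lift _ _ _ ≫ (pullback.fst π.left s.left ≫ 𝒳.hom) = pullback.fst π.left s.left ≫ 𝒳.hom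
      rw [pullback.lift_fst_assoc, Category.assoc, Over.w τ])

/-- `fiberOverEnd` followed by the first projection is the first projection followed by `τ`. [cite: Fulton1998, §10.1] -/
@[reassoc (attr := simp)]
theorem fiberOverEnd_left_fst (τ : 𝒳 ⟶ 𝒳) (hτ : τ ≫ π = π) (s : AlgPoints S k) :
    (fiberOverEnd π τ hτ s).left ≫ pullback.fst π.left s.left = pullback.fst π.left s.left ≫ τ.left :=
  pullback.lift_fst _ _ _

/-- `fiberOverEnd` commutes with the second projections to `Spec k`. [cite: Fulton1998, §10.1] -/
@[reassoc (attr := simp)]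
theorem fiberOverEnd_left_snd (τ : 𝒳 ⟶ 𝒳) (hτ : τ ≫ π = π) (s : AlgPoints S k) :
    (fiberOverEnd π τ hτ s).left ≫ pullback.snd π.left s.left = pullback.snd π.left s.left :=
  pullback.lift_snd _ _ _

/-- The induced endomorphism commutes with the fibre inclusion: `𝒳_s → 𝒳_s → 𝒳` equals `𝒳_s → 𝒳 → 𝒳`.
[cite: Fulton1998, §10.1] -/
@[reassoc]
theorem fiberOverEnd_comp_fiberι (τ : 𝒳 ⟶ 𝒳) (hτ : τ ≫ π = π) (s : AlgPoints S k) :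
    fiberOverEnd π τ hτ s ≫ fiberι π s = fiberι π s ≫ τ := by
  apply Over.OverMorphism.ext
  exact fiberOverEnd_left_fst π τ hτ s

/-- **Functoriality (identity)**: the identity of `𝒳` induces the identity of the fibre. [cite: Fulton1998, §10.1] -/
theorem fiberOverEnd_id (s : AlgPoints S k) :
    fiberOverEnd π (𝟙 𝒳) (Category.id_comp π) s = 𝟙 (fiberOver π s) := by
  apply Over.OverMorphism.ext
  apply pullback.hom_ext
  · rw [fiberOverEnd_left_fst]; simp
  · rw [fiberOverEnd_left_snd]; simp

/-- **Functoriality (composition)**: `(τ ≫ τ') ×_S Spec k = (τ ×_S Spec k) ≫ (τ' ×_S Spec k)`. [cite: Fulton1998, §10.1] -/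
theorem fiberOverEnd_comp (τ τ' : 𝒳 ⟶ 𝒳) (hτ : τ ≫ π = π) (hτ' : τ' ≫ π = π) (s : AlgPoints S k) :
    fiberOverEnd π (τ ≫ τ') (by rw [Category.assoc, hτ', hτ]) s =
      fiberOverEnd π τ hτ s ≫ fiberOverEnd π τ' hτ' s := by
  apply Over.OverMorphism.ext
  apply pullback.hom_ext
  · rw [fiberOverEnd_left_fst, Over.comp_left, Over.comp_left, Category.assoc, fiberOverEnd_left_fst,
      fiberOverEnd_left_fst_assoc]
  · rw [fiberOverEnd_left_snd, Over.comp_left, Category.assoc, fiberOverEnd_left_snd, fiberOverEnd_left_snd]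

/-- Equal endomorphisms induce equal fibre endomorphisms (proof-irrelevance of `hτ`). [cite: Fulton1998, §10.1] -/
theorem fiberOverEnd_congr {τ τ' : 𝒳 ⟶ 𝒳} (h : τ = τ') (hτ : τ ≫ π = π) (hτ' : τ' ≫ π = π)
    (s : AlgPoints S k) : fiberOverEnd π τ hτ s = fiberOverEnd π τ' hτ' s := by
  subst h; rfl

end FibreEnd

end Literature.AlgebraicGeometry.Motives

namespace Literature.AlgebraicGeometry.HodgeTheory

namespace BettiUniverse

open Literature.AlgebraicGeometry.Motives

section Quaternion

variable {X : Motives.SchemeOver ℂ}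

/-- `(f ≫ g)^* = f^* * g^*` in `Module.End ℚ Hᵏ(X(ℂ); ℚ)` (contravariance; `*` is composition). [cite: HatcherAT2002, §3.1 p. 198] -/
theorem pull_comp_eq_mul (f g : X ⟶ X) (k : ℕ) : pull (f ≫ g) k = pull f k * pull g k := by
  rw [Module.End.mul_eq_comp, pull_comp]

/-- **The cohomological quaternion relations of a deck pair.** If `τ j : X ⟶ X` satisfy `τ⁴ = 𝟙`, `j² = τ²` and
`τ j τ = j` (composition in diagrammatic order), then on every `Hᵏ(X(ℂ); ℚ)`:
`(τ^*)⁴ = 1`, `(j^*)² = (τ^*)²`, and `j^* τ^* = (τ^*)³ j^*` — the deck binders of the leaf `Q8SurfacePowersHodge`.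
[cite: HatcherAT2002, §3.1 p. 198] -/
theorem quaternionRelations_pull {τ j : X ⟶ X} (h4 : τ ≫ τ ≫ τ ≫ τ = 𝟙 X) (hj : j ≫ j = τ ≫ τ)
    (hτjτ : τ ≫ j ≫ τ = j) (k : ℕ) :
    pull τ k ^ 4 = 1 ∧ pull j k ^ 2 = pull τ k ^ 2 ∧ pull j k * pull τ k = pull τ k ^ 3 * pull j k := by
  have hτ2 : pull τ k ^ 2 = pull (τ ≫ τ) k := by rw [sq, pull_comp_eq_mul]
  have hτ3 : pull τ k ^ 3 = pull (τ ≫ τ ≫ τ) k := by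
    rw [pow_succ, hτ2, ← pull_comp_eq_mul, Category.assoc]
  have hτ4 : pull τ k ^ 4 = pull (τ ≫ τ ≫ τ ≫ τ) k := by
    rw [pow_succ, hτ3, ← pull_comp_eq_mul, Category.assoc, Category.assoc]
  refine ⟨?_, ?_, ?_⟩
  · rw [hτ4, h4, pull_id]; rfl
  · rw [sq, ← pull_comp_eq_mul, hj, hτ2]
  · -- `j ≫ τ = τ³ ≫ (τ ≫ j ≫ τ) = τ ≫ τ ≫ τ ≫ j` using `τ⁴ = 𝟙`
    have key : j ≫ τ = τ ≫ τ ≫ τ ≫ j := by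
      calc j ≫ τ = (τ ≫ τ ≫ τ ≫ τ) ≫ j ≫ τ := by rw [h4, Category.id_comp]
        _ = τ ≫ τ ≫ τ ≫ (τ ≫ j ≫ τ) := by simp only [Category.assoc]
        _ = τ ≫ τ ≫ τ ≫ j := by rw [hτjτ]
    rw [← pull_comp_eq_mul, key, hτ3, ← pull_comp_eq_mul, Category.assoc, Category.assoc]

/-- **The cohomological quaternion relations on the FIBRES of a deck family.** For `π : 𝒳 ⟶ S` and endomorphisms
`τ j` of `𝒳` over `S` with `τ⁴ = 𝟙`, `j² = τ²`, `τ j τ = j`, the induced endomorphisms `τ_s, j_s` of every fibre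
`𝒳_s` satisfy `(τ_s^*)⁴ = 1`, `(j_s^*)² = (τ_s^*)²`, `j_s^* τ_s^* = (τ_s^*)³ j_s^*` on every `Hᵏ(𝒳_s(ℂ); ℚ)` (M1-d (d-i):
the deck binders of the leaf, from `Q8FamilyDeck` (iv) by functoriality). [cite: HatcherAT2002, §3.1 p. 198] [cite: Fulton1998, §10.1] -/
theorem quaternionRelations_pull_fiberOverEnd {𝒳 S : Motives.SchemeOver ℂ} (π : 𝒳 ⟶ S) {τ j : 𝒳 ⟶ 𝒳}
    (hτ : τ ≫ π = π) (hjπ : j ≫ π = π) (h4 : τ ≫ τ ≫ τ ≫ τ = 𝟙 𝒳) (hj : j ≫ j = τ ≫ τ)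
    (hτjτ : τ ≫ j ≫ τ = j) (s : Motives.AlgPoints S ℂ) (k : ℕ) :
    pull (fiberOverEnd π τ hτ s) k ^ 4 = 1 ∧
      pull (fiberOverEnd π j hjπ s) k ^ 2 = pull (fiberOverEnd π τ hτ s) k ^ 2 ∧
      pull (fiberOverEnd π j hjπ s) k * pull (fiberOverEnd π τ hτ s) k =
        pull (fiberOverEnd π τ hτ s) k ^ 3 * pull (fiberOverEnd π j hjπ s) k := by
  have hττ : (τ ≫ τ) ≫ π = π := by rw [Category.assoc, hτ, hτ]
  have hτττ : (τ ≫ τ ≫ τ) ≫ π = π := by rw [Category.assoc, hττ, hτ]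
  refine quaternionRelations_pull ?_ ?_ ?_ k
  · rw [← fiberOverEnd_comp π τ τ hτ hτ s, ← fiberOverEnd_comp π τ (τ ≫ τ) hτ hττ s,
      ← fiberOverEnd_comp π τ (τ ≫ τ ≫ τ) hτ hτττ s, ← fiberOverEnd_id π s]
    exact fiberOverEnd_congr π h4 _ _ s
  · rw [← fiberOverEnd_comp π j j hjπ hjπ s, ← fiberOverEnd_comp π τ τ hτ hτ s]
    exact fiberOverEnd_congr π hj _ _ s
  · have hjτ : (j ≫ τ) ≫ π = π := by rw [Category.assoc, hτ, hjπ]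
    rw [← fiberOverEnd_comp π j τ hjπ hτ s, ← fiberOverEnd_comp π τ (j ≫ τ) hτ hjτ s]
    exact fiberOverEnd_congr π hτjτ _ _ s

end Quaternion

end BettiUniverse

end Literature.AlgebraicGeometry.HodgeTheory

end
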